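import Summits.QuantumFields.BalabanUV.Beta.GAN24.SecondResponseReadout
import Summits.QuantumFields.BalabanUV.Beta.GAN24.ExchangeBondLegs
import Summits.QuantumFields.BalabanUV.Beta.GAN24.MixedChannelBondSums

/-!
# `BalabanUV.Beta.GAN24.WSlotSourceZeroModeBond` — binder row G-an2-4 ∕ (CONV-C), W-slot road «W3» (gan24-p1 `SKELETON-W3.md` v1.0.2 §7.2∕§8.3),
# ROW W3-F2a, Part D-1 of the assembly: THE FOUR (S3c)-CHANNEL ff DOUBLE-LEG BOND SUMS IN THE UNSANDWICHED CURRENCY, generic data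

NOT IN PRINT; OUR BOOKKEEPING (G-an2-4 formalisation swarm, leaf prover `b2b-balaban-gan24-formalise-leaf-20`, gen 18; journal INTENT «W3-ZS*» l.9181;
name PROVISIONAL).  HONEST FRAMING (cell contract, verbatim): «discharging `BetaPertH` makes Bałaban's UV stability UNCONDITIONAL — a real
constructive-QFT result; it is NOT the continuum limit and NOT the Clay problem.»  HONEST DEPENDENCY (verbatim): «continuum YM on T⁴ ⇐ BetaPertH ∧
nine spine estimates (0/9 proved); BetaPertH ⇐ (D1) ∧ (D4) ∧ CAP+tail; G-an2-4 gates asym, D1 and NE2/3/4.»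

WHY.  Part B (`WSlotSourceZeroModeStep.inner_value_unitKStep_eq_zero`) takes the four channel facts as
`HasSum (u′ ↦ Σ'_{(y,w)} V u′ y w (inl α) (inl β)) 0` for the middles `V u′ ∈ {(dM_b ∘ K) ∘ dM_{(κ′,u′)}, (dM_{(κ′,u′)} ∘ K) ∘ dM_b,
dM (K2OfK … (κ′,u′)) … b, dM (K2OfK … b) … (κ′,u′)}`.  leaf-06-g9's «W3-S3C*» PART 6 landed the MECHANISMS at generic data: (C1)
`ExchangeBondLegs.hasSum_bond_legs_exchange` IS the first; the first-bond second-response one is the composition of (B1)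
`SecondResponseReadout.hasSum_legs_dM_of_biLoc` with the bond series of the multiplier-column position masses of `K2OfK … b` (an
intermediate step of `SecondResponseReadout.inner_resp_swap_eq_zero`, re-traced here over the exported atoms); the two remaining orientations
follow by leaf-14's TRANSPOSITION `MixedChannelBondSums.hasSum_firstBond_of_secondBond` from joint block covariance of the double-leg sums
(an2's `dM_translate` ∕ `K2OfK_translate` ∕ `dM_shiftK_translate`, `comp_shiftK`, gen-8 `tsum_prod_shiftK`).
* §1 `tsum_prod_exchange_translate`, `tsum_prod_resp_translate` — joint covariance of the double-leg sums.
* §2 **`hasSum_exchange_swap_bond`** — summed bond in the FIRST factor (the second-factor orientation IS (C1), consumed by name, not restated).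
* §3 **`hasSum_resp_swap_bond`** (`K2OfK … b` fixed, summed `dM` bond), **`hasSum_resp_bond`** (running `K2OfK`, by transposition).
[folklore] Fubini ∕ re-indexing over tree objects BY NAME; generic `d`, `N ≥ 1`; `K` given by decay + site-free coarse-leg charges vanishing on
multiplier legs (+ multiplier second legs vanishing off the coarse lattice for the exchange pair) + block covariance; `S` a `LocStencil` family
with the (S3c) sum rules as `HasSum` HYPOTHESES + block covariance; `M` a block-covariant `VertexFamily`.  Asserts NO shape or value of Bałaban's
tables; discharges NOTHING of ROW W3-F2a by itself (the step instance + plug is Part D-2); NOT «T2Shape», NOT (hW, hWall); NOT «W-slot closed»,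
NEVER «G-an2-4 closed»; NOT BetaPertH, NOT continuum, NOT Clay.  0 def, 0 cite, 0 `def … : Prop`, 0 sorry.
-/

noncomputable section

open Finset
open scoped BigOperators
open Literature.MathematicalPhysics.QuantumFieldTheory
open Literature.MathematicalPhysics.QuantumFieldTheory.Balaban1983to89
open Literature.MathematicalPhysics.QuantumFieldTheory.Balaban1983to89.Beta
open Literature.Probability.LatticeModels (Torus.proj)
open ExpKernelCalculus (Site MKer BiLoc Decays VertexFamily comp shiftK comp_shiftK)
open OneStepResolventKernel (Fib LocStencil decays_mono biLoc_mono)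
open SecondOrderResponse (colM dM K2OfK cK2 vertexFamily_dM vertexFamily_K2OfK dM_translate K2OfK_translate dM_shiftK_translate)
open BalabanStepJets (locStencil_mono)
open Summit.QuantumFields.BalabanUV.Beta.GAN24.KernelLegCharges (summable_prod_of_biLoc tsum_prod_shiftK)
open Summit.QuantumFields.BalabanUV.Beta.GAN24.ResolventLegCharges (hasSum_sandwich_readout)
open Summit.QuantumFields.BalabanUV.Beta.GAN24.DMBondCharges (hasSum_fibre_swap hasSum_dM_legs_ff)
open Summit.QuantumFields.BalabanUV.Beta.GAN24.SecondResponseReadout (tsum_readout_eq hasSum_legs_dM_of_biLoc)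
open Summit.QuantumFields.BalabanUV.Beta.GAN24.ExchangeBondLegs (hasSum_bond_legs_exchange)
open Summit.QuantumFields.BalabanUV.Beta.GAN24.MixedChannelBondSums (hasSum_firstBond_of_secondBond)

namespace Summit.QuantumFields.BalabanUV.Beta.GAN24.WSlotSourceZeroModeBond

variable {d : ℕ} {N : ℕ} [NeZero N]
variable {K : MKer (d + 1) (Fib d)} {C m : ℝ} {ρL ρR : Fin (d + 1) → Fib d → ℝ}
  {S : Fin (d + 1) → Site (d + 1) → MKer (d + 1) (Fib d)} {Cs : ℝ}
  {M : Fin (d + 1) → Site (d + 1) → MKer (d + 1) (Fib d)} {CM : ℝ}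

/-! ## §1 Joint block covariance of the double-leg sums -/

omit [NeZero N] in
/-- [folklore] The double-leg sum of the exchange middle `(dM_{(κ,v)} ∘ K) ∘ dM_{(κ′,w)}` is invariant under a joint translation of the two
bonds (block-covariant `K`, `S`, `M`: an2's `dM_translate`, `comp_shiftK`, gen-8 `tsum_prod_shiftK`). -/
theorem tsum_prod_exchange_translate [NeZero N] (hKs : ∀ t, shiftK (-((N : ℤ) • t)) K = K)
    (hSt : ∀ (κ : Fin (d + 1)) (u s : Site (d + 1)), S κ (u + (N : ℤ) • s) = shiftK (-((N : ℤ) • s)) (S κ u))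
    (hMt : ∀ (ρ : Fin (d + 1)) (w t : Site (d + 1)), M ρ (w + t) = shiftK (-((N : ℤ) • t)) (M ρ w))
    (κ : Fin (d + 1)) (v : Site (d + 1)) (κ' : Fin (d + 1)) (w t : Site (d + 1)) (f g : Fib d) :
    (∑' yz : Site (d + 1) × Site (d + 1), comp (comp (dM K N S M κ (v + t)) K) (dM K N S M κ' (w + t)) yz.1 yz.2 f g)
      = ∑' yz : Site (d + 1) × Site (d + 1), comp (comp (dM K N S M κ v) K) (dM K N S M κ' w) yz.1 yz.2 f g := by
  rw [dM_translate hKs hSt hMt κ v t, dM_translate hKs hSt hMt κ' w t]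
  have h : comp (comp (shiftK (-((N : ℤ) • t)) (dM K N S M κ v)) (shiftK (-((N : ℤ) • t)) K))
        (shiftK (-((N : ℤ) • t)) (dM K N S M κ' w))
      = shiftK (-((N : ℤ) • t)) (comp (comp (dM K N S M κ v) K) (dM K N S M κ' w)) := by
    rw [comp_shiftK, comp_shiftK]
  rw [hKs t] at h
  rw [h]
  exact tsum_prod_shiftK _ _ f g

omit [NeZero N] in
/-- [folklore] The double-leg sum of the second-response middle `dM (K2OfK K N S M κ v) N S M κ′ w` is invariant under a joint translation
of the two bonds (an2's `K2OfK_translate` ⨾ `dM_shiftK_translate`, gen-8 `tsum_prod_shiftK`). -/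
theorem tsum_prod_resp_translate [NeZero N] (hKs : ∀ t, shiftK (-((N : ℤ) • t)) K = K)
    (hSt : ∀ (κ : Fin (d + 1)) (u s : Site (d + 1)), S κ (u + (N : ℤ) • s) = shiftK (-((N : ℤ) • s)) (S κ u))
    (hMt : ∀ (ρ : Fin (d + 1)) (w t : Site (d + 1)), M ρ (w + t) = shiftK (-((N : ℤ) • t)) (M ρ w))
    (κ : Fin (d + 1)) (v : Site (d + 1)) (κ' : Fin (d + 1)) (w t : Site (d + 1)) (f g : Fib d) :
    (∑' yz : Site (d + 1) × Site (d + 1), dM (K2OfK K N S M κ (v + t)) N S M κ' (w + t) yz.1 yz.2 f g)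
      = ∑' yz : Site (d + 1) × Site (d + 1), dM (K2OfK K N S M κ v) N S M κ' w yz.1 yz.2 f g := by
  rw [K2OfK_translate hKs hSt hMt κ v t, dM_shiftK_translate (K2OfK K N S M κ v) hSt hMt κ' w t]
  exact tsum_prod_shiftK _ _ f g

/-! ## §2 The exchange pair -/

/-- [folklore] **EXCHANGE CHANNEL, summed bond in the FIRST factor**: under the hypotheses of (C1) `ExchangeBondLegs.hasSum_bond_legs_exchange`
plus block covariance of `K`, for every fixed bond `(κ, u)`: `HasSum (u′ ↦ Σ'_{(v,w)} ((dM_{(κ′,u′)} ∘ K) ∘ dM_{(κ,u)})(v,w)_{(inl a, inl b)}) 0` —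
(C1) at first bond `(κ′, 0)` summed over the second bond, transposed by leaf-14's `hasSum_firstBond_of_secondBond` (§1 covariance). -/
theorem hasSum_exchange_swap_bond (hK : Decays K C m) (hm : 0 < m) (hKs : ∀ t, shiftK (-((N : ℤ) • t)) K = K)
    (hrow : ∀ α f y, HasSum (fun x' : Site (d + 1) => K ((N : ℤ) • x') y (Sum.inr α) f) (ρL α f))
    (hcol : ∀ β g w, HasSum (fun z' : Site (d + 1) => K w ((N : ℤ) • z') g (Sum.inr β)) (ρR β g))
    (hL0 : ∀ α μ, ρL α (Sum.inr μ) = 0) (hR0 : ∀ β μ, ρR β (Sum.inr μ) = 0)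
    (hoffR : ∀ (x z : Site (d + 1)) (a : Fib d) (ρ : Fin (d + 1)), Torus.proj N z ≠ 0 → K x z a (Sum.inr ρ) = 0)
    (hS : LocStencil S Cs m)
    (hS0 : ∀ (κ : Fin (d + 1)) (t : Site (d + 1)) (a b : Fin (d + 1)),
      HasSum (fun vp : Site (d + 1) × Site (d + 1) => S κ t vp.1 vp.2 (Sum.inl a) (Sum.inl b)) 0)
    (hS2 : ∀ (κ : Fin (d + 1)) (p : Site (d + 1)) (a b : Fin (d + 1)),
      HasSum (fun tq : Site (d + 1) × Site (d + 1) => S κ tq.1 p tq.2 (Sum.inl a) (Sum.inl b)) 0)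
    (hSt : ∀ (κ : Fin (d + 1)) (u s : Site (d + 1)), S κ (u + (N : ℤ) • s) = shiftK (-((N : ℤ) • s)) (S κ u))
    (hM : VertexFamily M N CM m) (hMt : ∀ (ρ : Fin (d + 1)) (w t : Site (d + 1)), M ρ (w + t) = shiftK (-((N : ℤ) • t)) (M ρ w))
    (κ : Fin (d + 1)) (u : Site (d + 1)) (κ' a b : Fin (d + 1)) :
    HasSum (fun u' : Site (d + 1) => ∑' vw : Site (d + 1) × Site (d + 1),
      comp (comp (dM K N S M κ' u') K) (dM K N S M κ u) vw.1 vw.2 (Sum.inl a) (Sum.inl b)) 0 :=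
  hasSum_firstBond_of_secondBond
    (G := fun v w => ∑' vw : Site (d + 1) × Site (d + 1), comp (comp (dM K N S M κ' v) K) (dM K N S M κ w) vw.1 vw.2 (Sum.inl a) (Sum.inl b))
    (fun v w t => tsum_prod_exchange_translate hKs hSt hMt κ' v κ w t _ _) 0 u
    (hasSum_bond_legs_exchange hK hm hrow hcol hL0 hR0 hoffR hS hS0 hS2 hSt hM hMt κ' 0 κ a b)

/-! ## §3 The second-response pair -/

/-- [folklore] **SECOND-RESPONSE CHANNEL, `K2OfK … b` FIXED, summed `dM` bond**: under the hypotheses of (B1)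
`SecondResponseReadout.inner_resp_swap_eq_zero`, for every fixed bond `(κ, u)`:
`HasSum (u′ ↦ Σ'_{(v,p)} dM (K2OfK K N S M κ u) N S M κ′ u′ v p (inl a) (inl b)) 0` — per bond (B1) `hasSum_legs_dM_of_biLoc` leaves
`Σ_ρ c_ρ(u′) · Σ' M ρ 0 … ff` with `c_ρ(u′) = Σ'_w colM (K2OfK … κ u) N κ′ u′ ρ w`, and the bond series of `c_ρ` is the sandwich read-out of `dM_b`
on two multiplier charges = ff charges × (`dM_b` on two constant kernel legs) = 0 ((A) `hasSum_dM_legs_ff`; the intermediate step of (B1)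
`inner_resp_swap_eq_zero`, re-traced over the exported atoms). -/
theorem hasSum_resp_swap_bond (hK : Decays K C m) (hm : 0 < m)
    (hrow : ∀ α f y, HasSum (fun x' : Site (d + 1) => K ((N : ℤ) • x') y (Sum.inr α) f) (ρL α f))
    (hcol : ∀ β g w, HasSum (fun z' : Site (d + 1) => K w ((N : ℤ) • z') g (Sum.inr β)) (ρR β g))
    (hL0 : ∀ α μ, ρL α (Sum.inr μ) = 0) (hR0 : ∀ β μ, ρR β (Sum.inr μ) = 0) (hS : LocStencil S Cs m)
    (hS0 : ∀ (κ : Fin (d + 1)) (t : Site (d + 1)) (a b : Fin (d + 1)),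
      HasSum (fun vp : Site (d + 1) × Site (d + 1) => S κ t vp.1 vp.2 (Sum.inl a) (Sum.inl b)) 0)
    (hM : VertexFamily M N CM m) (hMt : ∀ (ρ : Fin (d + 1)) (w t : Site (d + 1)), M ρ (w + t) = shiftK (-((N : ℤ) • t)) (M ρ w))
    (κ : Fin (d + 1)) (u : Site (d + 1)) (κ' a b : Fin (d + 1)) :
    HasSum (fun u' : Site (d + 1) => ∑' vp : Site (d + 1) × Site (d + 1),
      dM (K2OfK K N S M κ u) N S M κ' u' vp.1 vp.2 (Sum.inl a) (Sum.inl b)) 0 := by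
  -- adapted from leaf-06-g9's `SecondResponseReadout.inner_resp_swap_eq_zero` (the `hcm` step), over its exported atoms
  have hC : 0 ≤ C := hK.nonneg (Sum.inl 0)
  have hCs : 0 ≤ Cs := (hS 0 0).nonneg (Sum.inl 0)
  have hCM : 0 ≤ CM := (hM 0 0).nonneg (Sum.inl 0)
  have hm8 : 0 < m / 8 := by positivity
  have hK2 : BiLoc (K2OfK K N S M κ u) ((N : ℤ) • u) ((N : ℤ) • u) (cK2 d C Cs CM m) (m / 8) := vertexFamily_K2OfK hK hC hm hS hM κ u
  have hS8 : LocStencil S Cs (m / 8) := locStencil_mono hS hCs (by linarith)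
  have hM8 : VertexFamily M N CM (m / 8) := fun ρ w => biLoc_mono (hM ρ w) hCM (by linarith)
  have hval : ∀ u' : Site (d + 1), (∑' vp : Site (d + 1) × Site (d + 1),
      dM (K2OfK K N S M κ u) N S M κ' u' vp.1 vp.2 (Sum.inl a) (Sum.inl b))
        = ∑ ρ : Fin (d + 1), (∑' w : Site (d + 1), colM (K2OfK K N S M κ u) N κ' u' ρ w) *
            ∑' vp : Site (d + 1) × Site (d + 1), M ρ 0 vp.1 vp.2 (Sum.inl a) (Sum.inl b) :=
    fun u' => (hasSum_legs_dM_of_biLoc hm8 hS8 hS0 hM8 hMt hK2 κ' u' a b).tsum_eq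
  -- the multiplier columns of `K` have zero position mass ((S2c), from the row charges)
  have hK0' : ∀ (μ ρ : Fin (d + 1)) (y : Site (d + 1)), HasSum (fun w : Site (d + 1) => colM K N μ y ρ w) 0 := by
    intro μ ρ y
    have h := hrow ρ (Sum.inr μ) ((N : ℤ) • y)
    rwa [hL0] at h
  -- the bond series of the multiplier-column position masses of `K2OfK … κ u` sums to zero
  have hcm : ∀ ρ : Fin (d + 1), HasSum (fun u' : Site (d + 1) => ∑' w : Site (d + 1), colM (K2OfK K N S M κ u) N κ' u' ρ w) 0 := by
    intro ρ
    have hVb := (vertexFamily_dM (N := N) hK hC hS hM hm le_rfl) κ u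
    have hsand := hasSum_sandwich_readout hK hm hVb (half_pos hm) ρ κ' (hrow ρ) (hcol κ')
    have hR : (∑' yw : Site (d + 1) × Site (d + 1), ∑ f, ∑ g, ρL ρ f * dM K N S M κ u yw.1 yw.2 f g * ρR κ' g) = 0 := by
      rw [tsum_readout_eq (hL0 ρ) (hR0 κ') (fun f g => summable_prod_of_biLoc hVb (half_pos hm) f g)]
      refine Finset.sum_eq_zero fun a _ => Finset.sum_eq_zero fun b _ => ?_
      rw [(hasSum_dM_legs_ff hK hm hK0' hS hS0 hM hMt κ u a b).tsum_eq, mul_zero]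
    rw [hR] at hsand
    have hG : HasSum (fun wu : Site (d + 1) × Site (d + 1) => colM (K2OfK K N S M κ u) N κ' wu.2 ρ wu.1) 0 := by
      have h := hsand.neg
      rw [neg_zero] at h
      exact h.congr_fun fun wu => by simp only [colM, K2OfK]
    have h := hasSum_fibre_swap hG.summable (fun w => (hG.summable.prod_factor w).hasSum)
    rwa [← hG.summable.tsum_prod, hG.tsum_eq] at h
  have h := hasSum_sum (s := (Finset.univ : Finset (Fin (d + 1)))) fun ρ _ =>
    (hcm ρ).mul_right (∑' vp : Site (d + 1) × Site (d + 1), M ρ 0 vp.1 vp.2 (Sum.inl a) (Sum.inl b))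
  simp only [zero_mul, Finset.sum_const_zero] at h
  exact h.congr_fun fun u' => hval u'

/-- [folklore] **SECOND-RESPONSE CHANNEL, RUNNING `K2OfK`, fixed `dM` bond**: under the same hypotheses plus block covariance of `K` and `S`,
for every fixed bond `(κ, u)`: `HasSum (u′ ↦ Σ'_{(v,p)} dM (K2OfK K N S M κ′ u′) N S M κ u v p (inl a) (inl b)) 0` — `hasSum_resp_swap_bond` at
first bond `(κ′, 0)` in the `K2OfK` slot with the `dM` bond summed, transposed by leaf-14's `hasSum_firstBond_of_secondBond` (§1 covariance). -/
theorem hasSum_resp_bond (hK : Decays K C m) (hm : 0 < m) (hKs : ∀ t, shiftK (-((N : ℤ) • t)) K = K)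
    (hrow : ∀ α f y, HasSum (fun x' : Site (d + 1) => K ((N : ℤ) • x') y (Sum.inr α) f) (ρL α f))
    (hcol : ∀ β g w, HasSum (fun z' : Site (d + 1) => K w ((N : ℤ) • z') g (Sum.inr β)) (ρR β g))
    (hL0 : ∀ α μ, ρL α (Sum.inr μ) = 0) (hR0 : ∀ β μ, ρR β (Sum.inr μ) = 0) (hS : LocStencil S Cs m)
    (hS0 : ∀ (κ : Fin (d + 1)) (t : Site (d + 1)) (a b : Fin (d + 1)),
      HasSum (fun vp : Site (d + 1) × Site (d + 1) => S κ t vp.1 vp.2 (Sum.inl a) (Sum.inl b)) 0)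
    (hSt : ∀ (κ : Fin (d + 1)) (u s : Site (d + 1)), S κ (u + (N : ℤ) • s) = shiftK (-((N : ℤ) • s)) (S κ u))
    (hM : VertexFamily M N CM m) (hMt : ∀ (ρ : Fin (d + 1)) (w t : Site (d + 1)), M ρ (w + t) = shiftK (-((N : ℤ) • t)) (M ρ w))
    (κ : Fin (d + 1)) (u : Site (d + 1)) (κ' a b : Fin (d + 1)) :
    HasSum (fun u' : Site (d + 1) => ∑' vp : Site (d + 1) × Site (d + 1),
      dM (K2OfK K N S M κ' u') N S M κ u vp.1 vp.2 (Sum.inl a) (Sum.inl b)) 0 :=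
  hasSum_firstBond_of_secondBond
    (G := fun v w => ∑' vp : Site (d + 1) × Site (d + 1), dM (K2OfK K N S M κ' v) N S M κ w vp.1 vp.2 (Sum.inl a) (Sum.inl b))
    (fun v w t => tsum_prod_resp_translate hKs hSt hMt κ' v κ w t _ _) 0 u
    (hasSum_resp_swap_bond hK hm hrow hcol hL0 hR0 hS hS0 hM hMt κ' 0 κ a b)

end Summit.QuantumFields.BalabanUV.Beta.GAN24.WSlotSourceZeroModeBond

end
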